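import Summits.QuantumFields.YangMills.Theses.MarginalTwistOnset

/-!
# Route `MarginalTwistOnset`, assembly item `Assembly` (stmt-QuantumFields-16127)

The assembly item of the route is, by construction, the type of the gate-written deciding theorem
`Summit.QuantumFields.YangMills.Theses.MarginalTwistOnset.closes` (rev 6): the six legs
`ExpScaleTwistOnset → FixedTorusCriterionFailure → SingleScaleFluxCriterion → LargeBetaFluxGap →
PinnedFluxGapToYangMills → CentrelessWeakCouplingYangMills` imply the sub-problem constant `YangMills`.
This file records that fact as a theorem whose type is literally the route declaration `Assembly`
(grounder g79-3 noted the same one-line proof on 2026-08-17; it was never landed).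

References: G. 't Hooft, *Nucl. Phys. B* 153 (1979) [Thooft1979] (the twist criterion the legs speak about).
-/

namespace Summit.QuantumFields.YangMills.Theorems.MarginalTwistOnsetGlue

open Summit.QuantumFields.YangMills.Theses.MarginalTwistOnset

/-- **Item stmt-QuantumFields-16127** (`Assembly`): the route's legs compose to the sub-problem statement — this is
exactly the deciding theorem `closes` of the route file. [cite: Thooft1979, §1 (the twist criterion named by the legs)] -/
theorem assembly_proof : Assembly := closes

end Summit.QuantumFields.YangMills.Theorems.MarginalTwistOnsetGlue
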